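import Mathlib

/-!
# LitMuInvariant — the p-adic μ-invariant chain of route/TIER3.md §1 item 3 / §6 chain A, typed AS PRINTED

Blind re-derivation cell `pub-hodge-repro`, Tier-4 literature seat `t4-lit-4` (gen 0).  Target tree path
`lean/Summits/Ventures/HodgeRepro/Tier4/LitMuInvariant.lean`; imports Mathlib only.

WHAT THIS FILE IS.  The two printed theorems the route's (R2)-branch consumes for its ONE named input R-B
(«the ℓ-adic Katz branch element on `Γ⁻_𝔩 ≅ ℤ_ℓ` is ≠ 0», TIER3.md §3 row R-B, §6 chain A steps (2)–(3)):

* **Hsieh 2014, Theorem A** (J. reine angew. Math. 688 (2014) 67–100; read on the AUTHOR COPY = arXiv:1112.1574v3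
  TeX source, operator deposit HOME/lit-deposits/Hsieh2014-arxiv1112.1574/, Main_Body.tex L73–L78; standing
  hypotheses L50–L69; proofs/t4/inputs/t4-lit-4.md row I-t4-lit-4-1):
  «Theorem A. Suppose that p ∤ D_F. Let χ be a self-dual Hecke character of K^× such that (R) the global root number
  W(χ*) = 1, where χ* := χ|·|^{−1/2}_{𝔸_K}. Then we have μ^−_{χ,Σ} = Σ_{v|𝔠^−} μ_p(χ_v).»
* **Burungale–Hida 2017, Theorem 1.2 = Theorem 6.1** (Algebra & Number Theory 11 (2017) 1921–1951; PRINT p. 1923 /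
  p. 1945, HOME/lit/t3-lit-g4-fetch/BurungaleHida2017-ANT11-print/pdf004.txt L47–L56 / pdf026.txt L33–L36;
  rows I-t4-lit-4-4 / -5): «Theorem 1.2. Let F/ℚ be a totally real extension, p an odd prime unramified in F and
  𝔭|p a prime in F. Let K/F be a p-ordinary CM quadratic extension. Let λ be an arithmetic Hecke character over K.
  Let L^−_{Σ,λ} (resp. L^−_{Σ,λ,𝔭}) be the corresponding anticyclotomic Katz p-adic (resp. anticyclotomic Katz
  p-adic) L-function as above. Then, we have μ(L^−_{Σ,λ}) = μ(L^−_{Σ,λ,𝔭}).»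

HOW THEY ARE TYPED (seat rule: named Props with the hypotheses explicit, NO proof of a published theorem).
The objects the theorems speak about (Hecke characters of a CM field, Katz measures) are not Mathlib objects; they
enter through an INTERFACE datum (`HsiehData`, `BHData`) whose fields are the printed objects in the tree's
vocabulary — the measures as elements of the Iwasawa algebra `A⟦Γ⟧ ≅ A⟦T_i⟧` (`MvPowerSeries`; for `Γ⁻_𝔭 ≅ ℤ_p`,
`σ = Unit`, this is the Tier-3 kernel's `G : PowerSeries A` of `Tier3BranchNonvanishing` / `Tier3Weierstrass`),
the local components `χ_v : K_v^× → A` as functions, and every printed HYPOTHESIS as a `Prop` field quoted from the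
page.  Each theorem is a `Prop` OVER its datum (as the night-2 / Tier-3 literature Props are over `C7Face L`): a
line instantiates the datum with its own objects and takes the Prop as a displayed hypothesis.  The μ-invariant
itself is DEFINED here (`muInv`): for an `A`-valued measure on `Γ ≅ ℤ_p^d`, `μ(φ) = inf_U v_p(φ(U))` (Hsieh L65–L66,
BH17 p. 1945 L27–L31) is the minimum of the valuations of the coefficients of its Iwasawa power series — the
infimum of `addVal A` over the coefficients.  PROVED here (Mathlib only): `muInv G = ⊤ ↔ G = 0`,
`muInv G = 0 ↔ G.map (residue A) ≠ 0` (the kernel's `hμ` of `Tier3BranchNonvanishing`), and the chain-A corollary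
«Theorem A ∧ Theorem 1.2 ⇒ the 𝔭-line branch element is ≠ 0» (`LminusP_ne_zero_of_chainA`) — under the theorems
as HYPOTHESES and the printed hypotheses of both, with `μ_p(χ_v) < ∞` supplied by «χ_v ≢ 1» (χ_v ramified at v | 𝔠^−).

HONESTY.  Nothing about Hecke characters, measures or L-values is proved; the `Prop` fields of the data are the
printed hypotheses, true or false according to the line's instance — this file asserts none of them.  The Crelle
print of Hsieh 2014 is NOT held (WANTED W14-print; the author's 2021 revision states Theorem A identically, letter
`λ*` for `χ*`).  Nothing here says anything about the status of the Hodge conjecture for CM abelian varieties,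
which is NOT proved.
-/

set_option autoImplicit false

noncomputable section

namespace Summit.Ventures.HodgeRepro.Tier4.Lit.MuInvariant

open IsDiscreteValuationRing

variable {A : Type*} [CommRing A] [IsDomain A] [IsDiscreteValuationRing A]

/-! ### The Iwasawa μ-invariant of an element of `A⟦Γ⟧ ≅ A⟦T_i : i ∈ σ⟧` -/

/-- **The μ-invariant.**  For a `ℤ̄_p`-valued measure `φ` on a p-adic group `H`, «μ(φ) = inf_{U ⊂ H open} v_p(φ(U))»
(Hsieh 2014 Main_Body.tex L65–L66; BH17 p. 1945 L27–L31).  Under the Iwasawa isomorphism `A⟦Γ⟧ ≅ A⟦T_i : i ∈ σ⟧`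
(`Γ ≅ ℤ_p^σ`) this is the minimum of the valuations of the coefficients; we DEFINE it so, as the infimum of the
additive valuation of the DVR `A` over the coefficients.  For `σ = Unit` the argument is a `PowerSeries A` — the
Tier-3 branch element `G`. -/
def muInv {σ : Type*} (G : MvPowerSeries σ A) : ℕ∞ :=
  ⨅ m : σ →₀ ℕ, addVal A (MvPowerSeries.coeff m G)

/-- `μ(G) = ∞` iff `G = 0` (every coefficient vanishes). -/
theorem muInv_eq_top_iff {σ : Type*} (G : MvPowerSeries σ A) : muInv G = ⊤ ↔ G = 0 := by
  constructor
  · intro h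
    apply MvPowerSeries.ext
    intro m
    rw [MvPowerSeries.coeff_zero]
    apply addVal_eq_top_iff.mp
    apply le_antisymm le_top
    rw [← h]
    exact iInf_le _ m
  · rintro rfl
    simp [muInv]

/-- `μ(G) = 0` iff some coefficient of `G` is a unit. -/
theorem muInv_eq_zero_iff {σ : Type*} (G : MvPowerSeries σ A) :
    muInv G = 0 ↔ ∃ m : σ →₀ ℕ, IsUnit (MvPowerSeries.coeff m G) := by
  constructor
  · intro h
    have hne : (Set.range fun m : σ →₀ ℕ => addVal A (MvPowerSeries.coeff m G)).Nonempty :=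
      Set.range_nonempty _
    obtain ⟨m, hm⟩ := csInf_mem hne
    beta_reduce at hm
    rw [sInf_range] at hm
    refine ⟨m, addVal_eq_zero_iff.mp ?_⟩
    rw [hm]
    exact h
  · rintro ⟨m, hm⟩
    apply le_antisymm _ zero_le
    calc muInv G ≤ addVal A (MvPowerSeries.coeff m G) := iInf_le _ m
      _ = 0 := addVal_eq_zero_iff.mpr hm

/-- **`μ(G) = 0` iff `G ≢ 0 (mod ϖ)`** — the form in which the kernel chain takes the named input
(`Tier3BranchNonvanishing.branch_ne_zero_of_map_residue_ne_zero`, hypothesis `hμ : G.map (residue A) ≠ 0`). -/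
theorem muInv_eq_zero_iff_map_residue_ne_zero {σ : Type*} (G : MvPowerSeries σ A) :
    muInv G = 0 ↔ MvPowerSeries.map (IsLocalRing.residue A) G ≠ 0 := by
  rw [muInv_eq_zero_iff, Ne, MvPowerSeries.eq_zero_iff_forall_coeff_zero]
  simp only [MvPowerSeries.coeff_map, not_forall]
  constructor
  · rintro ⟨m, hm⟩
    exact ⟨m, (IsLocalRing.residue_ne_zero_iff_isUnit _).mpr hm⟩
  · rintro ⟨m, hm⟩
    exact ⟨m, (IsLocalRing.residue_ne_zero_iff_isUnit _).mp hm⟩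

/-- `μ(G) < ∞` iff `G ≠ 0`. -/
theorem muInv_ne_top_iff {σ : Type*} (G : MvPowerSeries σ A) : muInv G ≠ ⊤ ↔ G ≠ 0 :=
  not_congr (muInv_eq_top_iff G)

/-! ### Hsieh 2014, Theorem A -/

/-- **The datum of Hsieh's Theorem A** (Main_Body.tex L50–L69, row I-t4-lit-4-1): `p > 2`; `F` totally real of degree
`d`, `K/F` totally imaginary quadratic; (ord); a p-ordinary CM type `Σ`; `𝔠 = 𝔠⁺𝔠⁻` prime to `p`; a Hecke character `χ`
of infinity type `kΣ`, `k ≥ 1`, of prime-to-p conductor `𝔠`; the anticyclotomic measure `ℒ⁻_{χ,Σ}` on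
`Γ⁻` = «the maximal ℤ_p-free quotient of the anticyclotomic quotient Z(𝔠)⁻ of Z(𝔠)» (L62); the local components
`χ_v` at `v | 𝔠⁻`.  The value ring `A` is the ring of integers of a finite extension of `ℚ_p` containing the values
of `χ` and of the measure (Hsieh: `ℤ̄_p`-valued). -/
structure HsiehData (A : Type*) [CommRing A] [IsDomain A] [IsDiscreteValuationRing A] where
  /-- the anticyclotomic variables: `Γ⁻ ≅ ℤ_p^{Var}`, `A⟦Γ⁻⟧ ≅ A⟦T_i : i ∈ Var⟧` (`|Var| = d = [F : ℚ]`). -/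
  Var : Type
  /-- `ℒ⁻_{χ,Σ}` — «the p-adic measure on `Γ⁻` obtained by the pull-back of `ℒ_{𝔠,Σ}` along `χ`» (L62–L63), as an
  element of the Iwasawa algebra. -/
  branch : MvPowerSeries Var A
  /-- the finite places of `F`. -/
  Place : Type
  /-- the places `v | 𝔠⁻` of `F` (`𝔠⁻` «a product of ramified or inert prime factors over `F`», L54) — a finite set. -/
  badPlaces : Finset Place
  /-- `K_v^×` at the place `v`. -/
  Kv : Place → Type
  /-- the local component `χ_v : K_v^× → A^× ⊂ A` of the branch character. -/
  chiLocal : (v : Place) → Kv v → A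
  /-- «Let p > 2 be an odd rational prime.» (L50) -/
  pOdd : Prop
  /-- «(ord) Every prime of F above p splits in K.» (L51) -/
  ord : Prop
  /-- «Fix a p-ordinary CM type Σ, namely Σ is a CM type of K such that p-adic places induced by elements in Σ via
  ι_p are disjoint from those induced by elements in Σc.» (L52) -/
  pOrdinaryType : Prop
  /-- «We fix a Hecke character χ of infinity type kΣ with k ≥ 1» (L61). -/
  infinityType : Prop
  /-- «𝔠 is the prime-to-p conductor [of] χ» (L62), `𝔠` «a prime-to-p integral ideal of K» (L54). -/
  conductor : Prop
  /-- «we say χ is self-dual if χ|_{𝔸_F^×} = τ_{K/F}|·|_{𝔸_F}, where τ_{K/F} is the quadratic character associated to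
  K/F» (L69). -/
  selfDual : Prop
  /-- «(R) the global root number W(χ*) = 1, where χ* := χ|·|^{−1/2}_{𝔸_K}» (L37–L41, L75). -/
  rootNumberOne : Prop
  /-- «Suppose that p ∤ D_F» (L74; `D_F` the discriminant of `F`, L50). -/
  pNotDvdDisc : Prop

namespace HsiehData

variable (D : HsiehData A)

/-- **The local invariant** «μ_p(χ_v) := inf_{x ∈ K_v^×} v_p(χ_v(x) − 1)» (Main_Body.tex L67–L68). -/
def muLocal (v : D.Place) : ℕ∞ := ⨅ x : D.Kv v, addVal A (D.chiLocal v x - 1)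

/-- the printed hypotheses of Theorem A, bundled. -/
def Hypotheses : Prop :=
  D.pOdd ∧ D.ord ∧ D.pOrdinaryType ∧ D.infinityType ∧ D.conductor ∧ D.selfDual ∧ D.rootNumberOne ∧ D.pNotDvdDisc

/-- `μ_p(χ_v) < ∞` as soon as `χ_v` takes one value `≠ 1` (in particular when `χ_v` is ramified). -/
theorem muLocal_ne_top_of_exists_ne_one (v : D.Place) (h : ∃ x : D.Kv v, D.chiLocal v x ≠ 1) :
    D.muLocal v ≠ ⊤ := by
  obtain ⟨x, hx⟩ := h
  intro htop
  have hle : D.muLocal v ≤ addVal A (D.chiLocal v x - 1) := iInf_le _ x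
  rw [htop, top_le_iff, addVal_eq_top_iff, sub_eq_zero] at hle
  exact hx hle

end HsiehData

/-- **Hsieh 2014, Theorem A, as printed** (author copy Main_Body.tex L73–L78; row I-t4-lit-4-1): over the datum
`D`, under the printed hypotheses, «μ^−_{χ,Σ} = Σ_{v|𝔠^−} μ_p(χ_v)». -/
def Hsieh2014_ThmA (D : HsiehData A) : Prop :=
  D.Hypotheses → muInv D.branch = ∑ v ∈ D.badPlaces, D.muLocal v

/-- **Corollary of Theorem A** (proved): the branch measure is NON-ZERO (`μ < ∞`) as soon as every local component
`χ_v`, `v | 𝔠⁻`, takes a value `≠ 1`. -/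
theorem Hsieh2014_ThmA.branch_ne_zero {D : HsiehData A} (h : Hsieh2014_ThmA D) (hD : D.Hypotheses)
    (hloc : ∀ v ∈ D.badPlaces, ∃ x : D.Kv v, D.chiLocal v x ≠ 1) : D.branch ≠ 0 := by
  rw [← muInv_ne_top_iff, h hD]
  exact ENat.sum_ne_top.mpr fun v hv => D.muLocal_ne_top_of_exists_ne_one v (hloc v hv)

/-! ### Burungale–Hida 2017, Theorem 1.2 = Theorem 6.1 -/

/-- **The datum of BH17 Theorem 1.2** (print p. 1923 L2–L39, p. 1944–1945; rows I-t4-lit-4-4 / -5): the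
`(d+1)`-variable Katz measure «L_{Σ,λ} = L_{Σ,λ}(T_1, …, T_d, S) ∈ ℤ_p[[Γ]]» (p. 1923 L22–L24) and its two
projections «L^−_{Σ,λ} ∈ ℤ_p[[Γ^−]] (resp. L^−_{Σ,λ,𝔭} ∈ ℤ_p[[Γ^−_𝔭]]) … obtained from the projection
π^−: ℤ_p[[Γ]] ↠ ℤ_p[[Γ^−]] (resp. π^−_𝔭: ℤ_p[[Γ]] ↠ ℤ_p[[Γ^−_𝔭]])» (L28–L35), with `Γ^−_𝔭 = Gal(K^−_{𝔭,∞}/K)`,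
`K^−_{𝔭,∞}` «the maximal subextension [of `K^−_∞`] unramified outside the primes above 𝔭 in K» (L9–L19). -/
structure BHData (A : Type*) [CommRing A] [IsDomain A] [IsDiscreteValuationRing A] where
  /-- the variables of `Γ ≅ ℤ_p^{Var}` (`T_1, …, T_d, S`). -/
  Var : Type
  /-- the anticyclotomic variables of `Γ^− ≅ ℤ_p^{VarMinus}`. -/
  VarMinus : Type
  /-- the variables of `Γ^−_𝔭` (rank `[F_𝔭 : ℚ_p]`; `Unit` when `𝔭` has degree one, the route's case). -/
  VarP : Type
  /-- `L_{Σ,λ} ∈ A⟦Γ⟧`. -/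
  full : MvPowerSeries Var A
  /-- `π^−: A⟦Γ⟧ ↠ A⟦Γ^−⟧` (the ring map induced by `Γ ↠ Γ^−`). -/
  piMinus : MvPowerSeries Var A →+* MvPowerSeries VarMinus A
  /-- `π^−_𝔭: A⟦Γ⟧ ↠ A⟦Γ^−_𝔭⟧`. -/
  piMinusP : MvPowerSeries Var A →+* MvPowerSeries VarP A
  /-- «p an odd prime unramified in F» (p. 1923 L47). -/
  pOddUnramified : Prop
  /-- «Let K/F be a p-ordinary CM quadratic extension» (L48) = «(ord) Every prime of F above p splits in K»
  (p. 1922 L40), with the p-adic CM type `Σ` fixed (p. 1923 L2–L4). -/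
  pOrdinary : Prop
  /-- «Let λ be an arithmetic Hecke character over K» (L48–L49). -/
  arithmetic : Prop
  /-- «Let C be a prime-to-p integral ideal of K. … Suppose that C is the prime-to-p conductor of λ» (L20–L21). -/
  conductorPrimeToP : Prop

namespace BHData

variable (D : BHData A)

/-- `L^−_{Σ,λ} = π^−(L_{Σ,λ})`. -/
def Lminus : MvPowerSeries D.VarMinus A := D.piMinus D.full

/-- `L^−_{Σ,λ,𝔭} = π^−_𝔭(L_{Σ,λ})`. -/
def LminusP : MvPowerSeries D.VarP A := D.piMinusP D.full

/-- the printed hypotheses of Theorem 1.2, bundled. -/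
def Hypotheses : Prop := D.pOddUnramified ∧ D.pOrdinary ∧ D.arithmetic ∧ D.conductorPrimeToP

end BHData

/-- **Burungale–Hida 2017, Theorem 1.2 (= Theorem 6.1), as printed** (ANT 11 (2017) p. 1923 L47–L56 / p. 1945
L33–L36; rows I-t4-lit-4-4 / -5): over the datum `D`, under the printed hypotheses,
«μ(L^−_{Σ,λ}) = μ(L^−_{Σ,λ,𝔭})». -/
def BurungaleHida2017_Thm1_2 (D : BHData A) : Prop :=
  D.Hypotheses → muInv D.Lminus = muInv D.LminusP

/-- **Corollary (proved): the 𝔭-line branch element is non-zero iff the full anticyclotomic one is.** -/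
theorem BurungaleHida2017_Thm1_2.LminusP_ne_zero_iff {D : BHData A} (h : BurungaleHida2017_Thm1_2 D)
    (hD : D.Hypotheses) : D.LminusP ≠ 0 ↔ D.Lminus ≠ 0 := by
  rw [← muInv_ne_top_iff, ← muInv_ne_top_iff, h hD]

/-! ### Chain A, steps (2)–(3): Theorem A ∧ Theorem 1.2 ⇒ the 𝔭-line branch element is `≠ 0` -/

/-- **TIER3.md §6 chain A, steps (2)–(3), on the kernel**: if Hsieh's Theorem A holds for the datum `DH` (branch
character `χ = λ`), BH17's Theorem 1.2 holds for the datum `DB` (the same `λ`), the two anticyclotomic measures are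
the same object (`hlink`: equal μ-invariants suffice), and every `χ_v`, `v | 𝔠⁻`, takes a value `≠ 1`, then the
𝔭-line branch element `L^−_{Σ,λ,𝔭}` is non-zero — the hypothesis `hG : G j ≠ 0` of
`Tier3BranchNonvanishing.four_line_pinning_of_branch_ne_zero` for that line (with `DB.VarP = Unit`).  Both theorems
enter as HYPOTHESES; nothing printed is proved. -/
theorem LminusP_ne_zero_of_chainA {DH : HsiehData A} {DB : BHData A} (hH : Hsieh2014_ThmA DH)
    (hB : BurungaleHida2017_Thm1_2 DB) (hDH : DH.Hypotheses) (hDB : DB.Hypotheses)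
    (hlink : muInv DB.Lminus = muInv DH.branch)
    (hloc : ∀ v ∈ DH.badPlaces, ∃ x : DH.Kv v, DH.chiLocal v x ≠ 1) : DB.LminusP ≠ 0 := by
  rw [← muInv_ne_top_iff, ← hB hDB, hlink, muInv_ne_top_iff]
  exact hH.branch_ne_zero hDH hloc

end Summit.Ventures.HodgeRepro.Tier4.Lit.MuInvariant

end
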